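import Literature.NumberTheory.LFunctions.CertifiedDirichletLTuringAssembled
import Literature.NumberTheory.LFunctions.TuringMethodTrudgianNumerics
import HarnessLib

/-!
# Turing's method for Dirichlet `L`-functions: a numerical bound for `∫S(t,χ)dt + ∫S(t,χ̄)dt`
# (Trudgian 2011, §3.5 / Theorem 3.3-type), from the `ζ` ladder's certified constants

Trudgian 2011, §3.5 evaluates the constants `a(c,d)`, `b(c,d)` of his Theorem 3.8 numerically
(`a(1.17,0.88) = 1.9744`, `b(1.17,0.88) = 0.0833`, his Theorem 3.3).  This file does the same for the
pair form proved in `CertifiedDirichletLTuringAssembled.lean`, at the parameters `(c, d) = (1.11, ¾)` of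
the tree's CERTIFIED evaluation of `ζ` (`TuringMethodTrudgianNumerics.lean`: certified Euler–Maclaurin
values of `log ζ`, trapezoid bounds for `∫ log ζ`, the secant bound for `−ζ'/ζ(5/4)`), with
`t₀ = 50` (Rumely's threshold):

* `TuringDirichlet.integral_lfunctionArgS_pair_le_numeric_of_check` — granted the certified
  computation `TrudgianNumerics.trudgianCheck = true` and Booker's inequality
  (`Trudgian2011_lemma_2_10`): for a primitive `χ` modulo `q > 1` and `50 < t₁ ≤ t₂` (ordinates of no
  zero of `L(s,χ)L(s,χ̄)` in the critical strip),
  `∫_{t₁}^{t₂} S(t,χ) dt + ∫_{t₁}^{t₂} S(t,χ̄) dt ≤ 2·(2.26 + 0.0642 log(q t₂/2π))`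
  (compare Rumely's `1.8397 + 0.1242 log`, Trudgian's `1.975 + 0.084 log` per character; the constants
  here are not optimised in `(c, d)`).
* `LFunctionRHUpTo.of_turing_numeric_of_check` — the corresponding GRH-verification step.

Everything here is a theorem; no new named fact; no new certified computation (the `native_decide`
evaluation `TrudgianNumerics.trudgianCheck_eq_true` lives in `TuringMethodTrudgianNumericsCheck.lean`
and is NOT imported here — users discharge the hypothesis `trudgianCheck = true` with it).

## References
* T. S. Trudgian, Improvements to Turing's method, Math. Comp. 80 (2011), §3.5, Theorems 3.3, 3.8
  (arXiv:0903.1885 p. 10). [Trudgian2011]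
* R. Rumely, Math. Comp. 61 (1993), Theorem 2. [Rumely1993ERH]
-/

noncomputable section

open Complex Set MeasureTheory intervalIntegral Filter Topology
open scoped Real

namespace Literature.NumberTheory.LFunctions

open DirichletTheta DirichletCharacter ExplicitPsiChar Trudgian2011Dirichlet TrudgianNumerics

namespace TuringDirichlet

variable {q : ℕ} [NeZero q] {χ : DirichletCharacter ℂ q}

/-- `log ζ(σ)` in Trudgian's notation equals `log ‖ζ(σ)‖` for `σ > 1`. [folklore] -/
private theorem logZeta_eq_log_norm {σ : ℝ} (hσ : 1 < σ) :
    logZeta σ = Real.log ‖riemannZeta σ‖ := by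
  rw [logZeta, norm_riemannZeta_ofReal_eq_re hσ]

/-- `∫_{(c,∞)} log ζ` in Trudgian's notation equals `∫_{(c,∞)} log ‖ζ‖` for `c > 1`. [folklore] -/
private theorem setIntegral_logZeta_eq {c : ℝ} (hc : 1 < c) :
    ∫ σ in Ioi c, logZeta σ = ∫ σ in Ioi c, Real.log ‖riemannZeta σ‖ :=
  setIntegral_congr_fun measurableSet_Ioi fun _ hσ ↦ logZeta_eq_log_norm (hc.trans hσ)

/-- **The constant `a₁(1.11, 50) ≤ 2.826642`** from the certified `log ζ(1.11) ≤ 2.2696563886` and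
`∫_{1.11}^{30} log ζ ≤ 1.4420089683` (tail beyond `30` below `10⁻⁸`). [cite: Trudgian2011, §3.5] -/
theorem dirichletA₁_le
    (I1 : (∫ σ in (111 / 100 : ℝ)..30, Real.log ‖riemannZeta σ‖) ≤ 1.4420089683)
    (G : Real.log ‖riemannZeta (((111 / 100 : ℝ)) : ℂ)‖ ≤ 2.2696563886) :
    729 / (2048 * (50 : ℝ) ^ 2) + (111 / 100 - 1 / 2) * logZeta (111 / 100) +
        ∫ σ in Ioi (111 / 100 : ℝ), logZeta σ ≤ 2.826642 := by
  have hc : (1 : ℝ) < 111 / 100 := by norm_num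
  rw [logZeta_eq_log_norm hc, setIntegral_logZeta_eq hc,
    setIntegral_Ioi_eq_intervalIntegral_add (f := fun σ : ℝ ↦ Real.log ‖riemannZeta σ‖)
      (show (111 / 100 : ℝ) ≤ 30 by norm_num) (integrableOn_log_norm_riemannZeta_ofReal hc)]
  have htail := setIntegral_Ioi_log_norm_riemannZeta_tail_le (X := 30) (by norm_num)
  have htail' : 4 * (2 : ℝ) ^ (-(30 : ℝ)) / Real.log 2 ≤ 1 / 10 ^ 8 := by
    have hl := Real.log_two_gt_d9
    rw [Real.rpow_neg (by norm_num), Real.rpow_ofNat, div_le_div_iff₀ (by linarith) (by norm_num)]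
    norm_num; linarith
  have hG' : (111 / 100 - 1 / 2 : ℝ) * Real.log ‖riemannZeta (((111 / 100 : ℝ)) : ℂ)‖ ≤
      (111 / 100 - 1 / 2) * 2.2696563886 := mul_le_mul_of_nonneg_left G (by norm_num)
  push_cast at hG' I1 htail ⊢
  nlinarith [hG', I1, htail, htail']

/-- **The constant `a₂(¾, 50) ≤ 4.266146`** (`a₂ = d² log 4 (2ζ'/ζ(1+2d) − ζ'/ζ(½+d) + ε'(t₀))
+ d² ε(t₀) − I(d)`) from the certified secant data at `5/4`, the certified `∫ log ζ` over `[1.25, 2.5]`,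
`[1.25, 2]`, `[4, 30]`, `2ζ'/ζ(5/2) ≤ 0`, and `π < 3.141593`. [cite: Trudgian2011, §3.5] -/
theorem dirichletA₂_le
    (I2 : (∫ σ in (5 / 4 : ℝ)..(5 / 2), Real.log ‖riemannZeta σ‖) ≤ 0.8393389420)
    (I3 : (∫ σ in (5 / 4 : ℝ)..2, Real.log ‖riemannZeta σ‖) ≤ 0.6470996291)
    (I4 : (∫ σ in (4 : ℝ)..30, Real.log ‖riemannZeta σ‖) ≤ 0.1050705446)
    (GZm : Real.log ‖riemannZeta (((5 / 4 - 1 / 5000 : ℝ)) : ℂ)‖ ≤ 1.5256867400)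
    (GZ0 : (1.5249930917 : ℝ) ≤ Real.log ‖riemannZeta (((5 / 4 : ℝ)) : ℂ)‖) :
    (3 / 4 : ℝ) ^ 2 * Real.log 4 *
          ((2 * (deriv riemannZeta (2 * (1 / 2 + 3 / 4) : ℝ) / riemannZeta (2 * (1 / 2 + 3 / 4) : ℝ)).re -
              (deriv riemannZeta (1 / 2 + 3 / 4 : ℝ) / riemannZeta (1 / 2 + 3 / 4 : ℝ)).re) +
            turingEps' 50) +
        (3 / 4 : ℝ) ^ 2 * turingEps 50 - turingI (3 / 4) ≤ 4.266146 := by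
  have r1 : (1 : ℝ) + 2 * (3 / 4) = 5 / 2 := by norm_num
  have r2 : (1 : ℝ) / 2 + 3 / 4 = 5 / 4 := by norm_num
  have r3 : (1 : ℝ) + 4 * (3 / 4) = 4 := by norm_num
  have r4 : (1 : ℝ) / 2 + 2 * (3 / 4) = 2 := by norm_num
  have r5 : (2 : ℝ) * (5 / 4) = 5 / 2 := by norm_num
  simp only [turingI, turingEps, turingEps', r1, r2, r3, r4, r5]
  -- the secant bound for `−ζ'/ζ(5/4)`
  have hZ : -(deriv riemannZeta ((5 / 4 : ℝ) : ℂ) / riemannZeta ((5 / 4 : ℝ) : ℂ)).re ≤ 3.4682415 := by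
    have hs := neg_re_logDeriv_riemannZeta_le_secant (σ₀ := 5 / 4) (h := 1 / 5000)
      (by norm_num) (by norm_num)
    have e : (Real.log ‖riemannZeta ((5 / 4 - 1 / 5000 : ℝ) : ℂ)‖ -
        Real.log ‖riemannZeta ((5 / 4 : ℝ) : ℂ)‖) / (1 / 5000) =
        5000 * (Real.log ‖riemannZeta ((5 / 4 - 1 / 5000 : ℝ) : ℂ)‖ -
          Real.log ‖riemannZeta ((5 / 4 : ℝ) : ℂ)‖) := by ring
    rw [e] at hs
    linarith
  -- `2 ζ'/ζ(5/2) ≤ 0`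
  have hZ2 : (deriv riemannZeta ((5 / 2 : ℝ) : ℂ) / riemannZeta ((5 / 2 : ℝ) : ℂ)).re ≤ 0 := by
    have h := norm_LSeries_vonMangoldt_le_of_one_lt_re (s := ((5 / 2 : ℝ) : ℂ)) (by simp; norm_num)
    have h0 := (norm_nonneg _).trans h
    simp only [ofReal_re] at h0
    rw [neg_div, neg_re] at h0
    linarith
  -- `π`
  have hπlo := Real.pi_gt_d6
  have hπhi := Real.pi_lt_d6
  have hε' : (4 : ℝ) / 50 ^ 2 + π / (4 * 50) ≤ 0.017308 := by
    rw [show (4 : ℝ) / 50 ^ 2 + π / (4 * 50) = 0.0016 + π / 200 by norm_num]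
    linarith
  have hε : (3 : ℝ) / (2 * 50 ^ 2) + π / (4 * 50) ≤ 0.016308 := by
    rw [show (3 : ℝ) / (2 * 50 ^ 2) + π / (4 * 50) = 0.0006 + π / 200 by norm_num]
    linarith
  obtain ⟨hl40, hl4⟩ := log_four_le
  -- the first product
  set Z := (deriv riemannZeta ((5 / 4 : ℝ) : ℂ) / riemannZeta ((5 / 4 : ℝ) : ℂ)).re with hZdef
  set Z2 := (deriv riemannZeta ((5 / 2 : ℝ) : ℂ) / riemannZeta ((5 / 2 : ℝ) : ℂ)).re with hZ2def
  have hM1 : 2 * Z2 - Z + (4 / 50 ^ 2 + π / (4 * 50)) ≤ 3.4855495 := by linarith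
  have hT1 : (3 / 4 : ℝ) ^ 2 * Real.log 4 * (2 * Z2 - Z + (4 / 50 ^ 2 + π / (4 * 50))) ≤ 2.717999 := by
    rcases le_or_gt 0 (2 * Z2 - Z + (4 / 50 ^ 2 + π / (4 * 50))) with hpos | hneg
    · calc (3 / 4 : ℝ) ^ 2 * Real.log 4 * (2 * Z2 - Z + (4 / 50 ^ 2 + π / (4 * 50)))
          ≤ (3 / 4 : ℝ) ^ 2 * Real.log 4 * 3.4855495 :=
            mul_le_mul_of_nonneg_left hM1 (by positivity)
        _ ≤ (3 / 4 : ℝ) ^ 2 * 1.3862943616 * 3.4855495 := by nlinarith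
        _ ≤ 2.717999 := by norm_num
    · have : (3 / 4 : ℝ) ^ 2 * Real.log 4 * (2 * Z2 - Z + (4 / 50 ^ 2 + π / (4 * 50))) ≤ 0 :=
        mul_nonpos_of_nonneg_of_nonpos (by positivity) hneg.le
      linarith
  have hT2 : (3 / 4 : ℝ) ^ 2 * (3 / (2 * 50 ^ 2) + π / (4 * 50)) ≤ 0.009174 := by nlinarith
  -- the integrals: `−I(¾) = ∫_{5/4}^{5/2} + ∫_{5/4}^{2} + ½ ∫_{4}^{∞}`
  have hI : IntegrableOn (fun σ : ℝ ↦ Real.log ‖riemannZeta σ‖) (Ioi (5 / 4)) :=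
    integrableOn_log_norm_riemannZeta_ofReal (by norm_num)
  have S2 := setIntegral_Ioi_eq_intervalIntegral_add (f := fun σ : ℝ ↦ Real.log ‖riemannZeta σ‖)
    (show (5 / 4 : ℝ) ≤ 5 / 2 by norm_num) hI
  have S3 := setIntegral_Ioi_eq_intervalIntegral_add (f := fun σ : ℝ ↦ Real.log ‖riemannZeta σ‖)
    (show (5 / 2 : ℝ) ≤ 4 by norm_num) (hI.mono_set (Ioi_subset_Ioi (by norm_num)))
  have S4 := setIntegral_Ioi_eq_intervalIntegral_add (f := fun σ : ℝ ↦ Real.log ‖riemannZeta σ‖)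
    (show (4 : ℝ) ≤ 30 by norm_num) (hI.mono_set (Ioi_subset_Ioi (by norm_num)))
  have htail := setIntegral_Ioi_log_norm_riemannZeta_tail_le (X := 30) (by norm_num)
  have htail' : 4 * (2 : ℝ) ^ (-(30 : ℝ)) / Real.log 2 ≤ 1 / 10 ^ 8 := by
    have hl2lo := Real.log_two_gt_d9
    rw [Real.rpow_neg (by norm_num), Real.rpow_ofNat, div_le_div_iff₀ (by linarith) (by norm_num)]
    norm_num; linarith
  rw [S2, S3, S4]
  nlinarith [hT1, hT2, I2, I3, I4, htail, htail', hZdef, hZ2def]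

/-- `b₁ + b₂ = ¼(c−½)² + (d²/2)(log 4 − 1) ≤ 0.2016703` at `(c, d) = (1.11, ¾)`. [cite: Trudgian2011, §3.5] -/
theorem dirichletB_le :
    ((111 / 100 : ℝ) - 1 / 2) ^ 2 / 4 + (3 / 4 : ℝ) ^ 2 / 2 * (Real.log 4 - 1) ≤ 0.2016703 := by
  obtain ⟨-, hl4⟩ := log_four_le
  nlinarith

/-- **A numerical Turing bound for Dirichlet `L`-functions** (Trudgian 2011 §3.5 / Theorem 3.3-type,
pair form, at `(c,d) = (1.11, ¾)`, `t₀ = 50`): granted the certified `ζ` computation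
`trudgianCheck = true` of the tree and Booker's inequality, for a primitive `χ` modulo `q > 1` and
`50 < t₁ ≤ t₂`, `t₁, t₂` ordinates of no zero of `L(s,χ)` or `L(s,χ̄)` with `0 < Re s < 1`,
`∫_{t₁}^{t₂} S(t,χ) dt + ∫_{t₁}^{t₂} S(t,χ̄) dt ≤ 2·(2.26 + 0.0642·log(q t₂/2π))`.
(Printed comparators per character: Rumely `1.8397 + 0.1242 log`, Trudgian `1.975 + 0.084 log`.)
[cite: Trudgian2011, §3.5 and Theorem 3.3] -/
theorem integral_lfunctionArgS_pair_le_numeric_of_check (hcheck : trudgianCheck = true)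
    (hB : Trudgian2011_lemma_2_10) (hq : 1 < q) (hχ : χ.IsPrimitive) {t₁ t₂ : ℝ} (h01 : 50 < t₁)
    (h12 : t₁ ≤ t₂)
    (hz₁ : ∀ ρ ∈ charNontrivialZeros χ, ρ.im ≠ t₁) (hz₁' : ∀ ρ ∈ charNontrivialZeros χ⁻¹, ρ.im ≠ t₁)
    (hz₂ : ∀ ρ ∈ charNontrivialZeros χ, ρ.im ≠ t₂) (hz₂' : ∀ ρ ∈ charNontrivialZeros χ⁻¹, ρ.im ≠ t₂) :
    (∫ t in t₁..t₂, lfunctionArgS χ t) + ∫ t in t₁..t₂, lfunctionArgS χ⁻¹ t ≤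
      2 * (2.26 + 0.0642 * Real.log (q * t₂ / (2 * π))) := by
  obtain ⟨I1, I2, I3, I4, ok1, okZm, okZ0, -, -, -, -⟩ := bounds_of_trudgianCheck hcheck
  have e1 : ((11100 : ℕ) : ℝ) / 10 ^ 4 = 111 / 100 := by norm_num
  have e2 : ((300000 : ℕ) : ℝ) / 10 ^ 4 = 30 := by norm_num
  have e3 : ((12500 : ℕ) : ℝ) / 10 ^ 4 = 5 / 4 := by norm_num
  have e4 : ((25000 : ℕ) : ℝ) / 10 ^ 4 = 5 / 2 := by norm_num
  have e5 : ((20000 : ℕ) : ℝ) / 10 ^ 4 = 2 := by norm_num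
  have e6 : ((40000 : ℕ) : ℝ) / 10 ^ 4 = 4 := by norm_num
  have e7 : ((12498 : ℕ) : ℝ) / 10 ^ 4 = 5 / 4 - 1 / 5000 := by norm_num
  rw [e1, e2] at I1; rw [e3, e4] at I2; rw [e3, e5] at I3; rw [e6, e2] at I4
  have G : Real.log ‖riemannZeta (((111 / 100 : ℝ)) : ℂ)‖ ≤ 2.2696563886 := by
    have := ok1.2; simp only at this; rw [e1] at this
    refine this.trans ?_; norm_num
  have GZm : Real.log ‖riemannZeta (((5 / 4 - 1 / 5000 : ℝ)) : ℂ)‖ ≤ 1.5256867400 := by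
    have := okZm.2; simp only at this; rw [e7] at this
    refine this.trans ?_; norm_num
  have GZ0 : (1.5249930917 : ℝ) ≤ Real.log ‖riemannZeta (((5 / 4 : ℝ)) : ℂ)‖ := by
    rw [e3] at okZ0; refine le_trans ?_ okZ0; norm_num
  have hTB1 : ((TB1 : ℚ) : ℝ) = 1.4420089683 := by norm_num [TB1]
  have hTB2 : ((TB2 : ℚ) : ℝ) = 0.8393389420 := by norm_num [TB2]
  have hTB3 : ((TB3 : ℚ) : ℝ) = 0.6470996291 := by norm_num [TB3]
  have hTB4 : ((TB4 : ℚ) : ℝ) = 0.1050705446 := by norm_num [TB4]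
  rw [hTB1] at I1; rw [hTB2] at I2; rw [hTB3] at I3; rw [hTB4] at I4
  have hA1 := dirichletA₁_le I1 G
  have hA2 := dirichletA₂_le I2 I3 I4 GZm GZ0
  have hBc := dirichletB_le
  have hmain := pi_mul_integral_lfunctionArgS_pair_le hB hq hχ (c := 111 / 100) (d := 3 / 4)
    (t₀ := 50) (by norm_num) (by norm_num) (by norm_num) (by norm_num) (by norm_num) h01 h12
    hz₁ hz₁' hz₂ hz₂'
  -- `log(q t₂/2π) ≥ 0`
  have hq2 : (2 : ℝ) ≤ q := by exact_mod_cast hq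
  have hL : 0 ≤ Real.log (q * t₂ / (2 * π)) := by
    refine Real.log_nonneg ?_
    rw [le_div_iff₀ (by positivity)]
    nlinarith [Real.pi_lt_d6]
  have hπ := Real.pi_gt_d6
  set S := (∫ t in t₁..t₂, lfunctionArgS χ t) + ∫ t in t₁..t₂, lfunctionArgS χ⁻¹ t with hS
  set L := Real.log (q * t₂ / (2 * π)) with hLdef
  have h1 : π * S ≤ 2 * (2.826642 + 4.266146) + 2 * 0.2016703 * L := by
    have := mul_le_mul_of_nonneg_right hBc hL
    linarith
  -- divide by `π > 3.141592`
  by_contra hcon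
  rw [not_le] at hcon
  have : π * (2 * (2.26 + 0.0642 * L)) < π * S := mul_lt_mul_of_pos_left hcon Real.pi_pos
  nlinarith

end TuringDirichlet

open TuringDirichlet TrudgianNumerics in
/-- **The GRH-verification step for `L(s,χ)` up to height `T > 50` with a numerical Turing bound**
(Platt 2016 Thm. 3.2 + the bound above): granted `trudgianCheck = true` (the tree's certified `ζ`
computation) and Booker's inequality, found zeros `W` (on the line, `|γ| ≤ T`, `#W = n`), `Z`, `Z'`
(on the line, ordinates in `(T, T+h]`, for `χ`, `χ̄`) and the single real inequality
`2(2.26 + 0.0642 log(q(T+h)/2π)) + (2/π)∫_T^{T+h} θ(t,χ)dt − Σ_Z(T+h−γ) − Σ_{Z'}(T+h−γ) < h(n+1)`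
certify `LFunctionRHUpTo χ T ∧ N_χ(T) = N_{χ,0}(T) = n`.
[cite: Platt2016GRH, Theorem 3.2] [cite: Trudgian2011, Theorem 3.3] -/
theorem LFunctionRHUpTo.of_turing_numeric_of_check (hcheck : TrudgianNumerics.trudgianCheck = true)
    (hB : Trudgian2011_lemma_2_10) {q : ℕ} [NeZero q] {χ : DirichletCharacter ℂ q}
    (hχ : χ.IsPrimitive) (hq : 1 < q) {T h : ℝ} {n : ℕ} (hT : 50 < T) (hh : 0 < h)
    (hz : ∀ ρ ∈ charNontrivialZeros χ, ρ.im ≠ T ∧ ρ.im ≠ -T)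
    (hzh : ∀ ρ ∈ charNontrivialZeros χ, ρ.im ≠ T + h ∧ ρ.im ≠ -(T + h))
    (W : Finset ℝ) (hW : ∀ γ ∈ W, χ.LFunction (1 / 2 + γ * I) = 0 ∧ |γ| ≤ T) (hWn : W.card = n)
    (Z : Finset ℝ) (hZ : ∀ γ ∈ Z, χ.LFunction (1 / 2 + γ * I) = 0 ∧ T < γ ∧ γ ≤ T + h)
    (Z' : Finset ℝ) (hZ' : ∀ γ ∈ Z', χ⁻¹.LFunction (1 / 2 + γ * I) = 0 ∧ T < γ ∧ γ ≤ T + h)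
    (hnum : 2 * (2.26 + 0.0642 * Real.log (q * (T + h) / (2 * π))) +
        2 / π * (∫ t in T..T + h, lfunctionTheta χ t) - ∑ γ ∈ Z, (T + h - γ) -
        ∑ γ ∈ Z', (T + h - γ) < h * (n + 1)) :
    LFunctionRHUpTo χ T ∧ lfunctionZeroCount χ T = n ∧ lfunctionCriticalZeroCount χ T = n := by
  have hq1 : q ≠ 1 := by omega
  have h1 : χ ≠ 1 := SelbergDirichlet.ne_one_of_isPrimitive hq1 hχ
  have hconj : ∀ {t : ℝ}, (∀ ρ ∈ charNontrivialZeros χ, ρ.im ≠ -t) →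
      ∀ ρ ∈ charNontrivialZeros χ⁻¹, ρ.im ≠ t := by
    intro t ht ρ hρ h
    have hρ' : (starRingEnd ℂ) ρ ∈ charNontrivialZeros χ := by
      have := (conj_mem_charNontrivialZeros_inv (χ := χ⁻¹) (inv_ne_one.mpr h1) (ρ := ρ)).2 hρ
      rwa [inv_inv] at this
    exact ht _ hρ' (by rw [Complex.conj_im, h])
  have hS := integral_lfunctionArgS_pair_le_numeric_of_check hcheck hB hq hχ hT (by linarith)
    (fun ρ hρ ↦ (hz ρ hρ).1) (hconj fun ρ hρ ↦ (hz ρ hρ).2)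
    (fun ρ hρ ↦ (hzh ρ hρ).1) (hconj fun ρ hρ ↦ (hzh ρ hρ).2)
  exact LFunctionRHUpTo.of_turing hχ hq (by linarith) hh.le hz W hW hWn Z hZ Z' hZ' hS hnum

end Literature.NumberTheory.LFunctions

end
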